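import Summits.Ventures.CertifiedArithmetic.Expansions.Orient3dStageCTerms
import Mathlib.Tactic.Linarith
import Mathlib.Tactic.Positivity
import Mathlib.Tactic.Ring
import Mathlib.Tactic.NormNum

/-!
# ORIENT3D, stage C, part 2: the sign test is sound under two explicit margins

Shared numerical engines serving client cells; rigour lives in the verifiers; every published number
belongs to a client cell's ledger, not to the engines group. NEW WORK (see part 1,
`Orient3dStageCTerms`, for the object and the honest framing: our transcription of `orient3dadapt`'s
stage C as hypotheses between rationals; nothing is claimed about the C code itself).

THE OBJECT. Stage C computes `errbound = (K_C ⊗ W) ⊕ (K_R ⊗ |det_B|)` from the stage-A permanent `W`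
and the stage-B value `det_B`, sets `det_C = det_B ⊕ c` (`c` the correction of part 1) and returns
`det_C` if `|det_C| ≥ errbound`. In `predicates.c`, `K_C = o3derrboundC = (26 + 288ε)ε²` and `K_R =
resulterrbound = (3 + 8ε)ε`.

THE RESULT. `orient3d_stageC_sign_of_bounds`: for ANY constants `K_C`, `K_R` and any estimate error
`δ` (`|det_B − B| ≤ δ|B|`, `B` the determinant over the rounded differences) satisfying (MC) `23ε² +
70ε³ + 123ε⁴ + 145ε⁵ + 113ε⁶ + 56ε⁷ + 16ε⁸ + 2ε⁹ < (1 − ε)⁷ K_C` and (MR) `δ < (1 − δ)(1 − ε)³ K_R`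
(`0 < ε ≤ 1/2`, `0 ≤ δ < 1`), a passed test forces `det_C ≠ 0` with the sign of the true determinant
`T` over the exact differences `x + xt`, in both directions. The proof: `T = B + L + R` with `L` the
first-order terms and `R` the remainder of part 1; `|det_C − T| ≤ ε|det_C| + δ|B| + |c − L| + |R| ≤
ε|det_C| + δ|B| + κ(ε)Π` with `κ = 23ε² + … + 2ε⁹` (part 1), while the permanent chain gives `W ≥ (1
− ε)⁴Π`, the bound `E ≥ (1 − ε)²(K_C W + K_R|det_B|)` and `(1 − δ)|B| ≤ |det_B|`; the margins turn
`δ|B| + κΠ` into strictly less than `(1 − ε)(E-part) ≤ (1 − ε)|det_C|` unless `Π = 0`, in which case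
everything including `det_C` vanishes.

THE FINDING (the margins are evaluated, and the rows below proved, in `Orient3dStageCMargins`;
recorded, not adjudicated). (MC) holds for Shewchuk's `K_C = (26 + 288ε)ε²` when `p ≥ 4` and fails
at `p = 3` (margin `ε²(3 + 36ε − 1593ε² + …)`). For (MR) everything hinges on the estimate error
`δ`: the paper (§2.7) asserts that `estimate` errs by less than one ulp, which is false for general
nonoverlapping expansions (`Orient2dEstimate`), and the bound this development works with for the
weakly nonoverlapping expansions stage B produces is `δ = 3ε` (exhaustive small-precision searches
found at most `2.38ε`, cf. `EstimateWeakExpansion`). With `δ = 3ε`, (MR) FAILS for Shewchuk's `K_R =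
(3 + 8ε)ε` at every precision (margin `−ε²(10 + 12ε)`) and holds for `K_R = (3 + 24ε)ε` when `p ≥
4`; with `δ = 2ε` it holds for `(3 + 8ε)ε` from `p ≥ 3` (with `δ = 2.5ε` from `p ≥ 5`, by
evaluation). So Table 3, line C rests on an estimate error of at most about `2.5ε` for the stage-B
expansion — plausible, not proved here. (MR) is a sufficient condition of OUR analysis: its failure
exhibits no input on which `predicates.c` errs, and we know of none.

Evidence gathered before typing (engines; not verification): in the exact rational model of part 1
(`p ∈ {4, 5, 6, 8, 11}`, 1 500 quadruples each) the end-to-end test with `(K_C, K_R) = ((26 +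
288ε)ε², (3 + 8ε)ε)` answered 34 / 57 / 95 / 236 / 353 times with no wrong sign, with `(3 + 24ε)ε`
33 / 56 / 95 / 236 / 353 times, no wrong sign; a control with both constants divided by 8 also
produced no wrong sign (153 / 230 / 292 / 381 / 404 answers), i.e. random sampling does not probe
these margins at all — the distinction between the constants is the analysis, not the experiment.
References: J. R. Shewchuk, Discrete Comput. Geom. 18 (1997) 305–363, §4.4, Table 3 [Shewchuk1997].
-/

namespace Summit.Ventures.CertifiedArithmetic.Expansions

/-- From `|a − r| ≤ u|a|` and `0 ≤ a`: `(1 − u)a ≤ r`. -/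
private theorem lower_of_rel {u a r : ℚ} (h : |a - r| ≤ u * |a|) (ha : 0 ≤ a) :
    (1 - u) * a ≤ r := by
  rw [abs_of_nonneg ha] at h
  have := (abs_sub_le_iff.mp h).1
  linarith

/-! ## The permanent and the error bound, from below -/

/-- The stage-A permanent chain bounds `(1 − ε)⁴·Π ≤ W` (`Π = Σ |z|(|P| + |Q|)`). -/
private theorem perm_ge {u za zb zc P₁ P₂ P₃ P₄ P₅ P₆ Aa Ab Ac αa αb αc W₁ W : ℚ} (hu0 : 0 ≤ u)
    (hu1 : u ≤ 1) (hAa : |(|P₁| + |P₂|) - Aa| ≤ u * |(|P₁| + |P₂|)|)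
    (hAb : |(|P₃| + |P₄|) - Ab| ≤ u * |(|P₃| + |P₄|)|)
    (hAc : |(|P₅| + |P₆|) - Ac| ≤ u * |(|P₅| + |P₆|)|)
    (hαa : |(Aa * |za|) - αa| ≤ u * |(Aa * |za|)|)
    (hαb : |(Ab * |zb|) - αb| ≤ u * |(Ab * |zb|)|)
    (hαc : |(Ac * |zc|) - αc| ≤ u * |(Ac * |zc|)|) (hW₁ : |(αa + αb) - W₁| ≤ u * |αa + αb|)
    (hW : |(W₁ + αc) - W| ≤ u * |W₁ + αc|) :
    (1 - u) ^ 4 * (|za| * (|P₁| + |P₂|) + |zb| * (|P₃| + |P₄|) + |zc| * (|P₅| + |P₆|)) ≤ W := by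
  have h1u : 0 ≤ 1 - u := by linarith
  have gA : ∀ {S A z : ℚ}, 0 ≤ S → |S - A| ≤ u * |S| → ∀ {α : ℚ},
      |(A * |z|) - α| ≤ u * |(A * |z|)| → (1 - u) ^ 2 * (|z| * S) ≤ α ∧ 0 ≤ α := by
    intro S A z hS hA α hα
    have hA1 : (1 - u) * S ≤ A := lower_of_rel hA hS
    have hA0 : 0 ≤ A := le_trans (mul_nonneg h1u hS) hA1
    have hAz0 : 0 ≤ A * |z| := mul_nonneg hA0 (abs_nonneg z)
    have hα1 : (1 - u) * (A * |z|) ≤ α := lower_of_rel hα hAz0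
    have h2 : (1 - u) * S * |z| ≤ A * |z| := mul_le_mul_of_nonneg_right hA1 (abs_nonneg z)
    have h3 := mul_le_mul_of_nonneg_left h2 h1u
    constructor
    · nlinarith
    · nlinarith
  obtain ⟨ga, ga0⟩ := gA (by positivity) hAa hαa
  obtain ⟨gb, gb0⟩ := gA (by positivity) hAb hαb
  obtain ⟨gc, gc0⟩ := gA (by positivity) hAc hαc
  have w1 : (1 - u) * (αa + αb) ≤ W₁ := lower_of_rel hW₁ (by linarith)
  have w10 : 0 ≤ W₁ := le_trans (by positivity) w1
  have w2 : (1 - u) * (W₁ + αc) ≤ W := lower_of_rel hW (by linarith)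
  have e1 : (1 - u) * αc ≤ αc := by nlinarith
  have e2 := mul_le_mul_of_nonneg_left w1 h1u
  have e3 := mul_le_mul_of_nonneg_left (add_le_add (add_le_add ga gb) gc) (pow_nonneg h1u 2)
  nlinarith

/-- The computed error bound `E = (K_C ⊗ W) ⊕ (K_R ⊗ |d_B|)` from below. -/
private theorem errC_ge {u KC KR W dB E₁ E₂ E : ℚ} (hu1 : u ≤ 1) (hKC : 0 ≤ KC)
    (hKR : 0 ≤ KR) (hW : 0 ≤ W) (hE₁ : |KC * W - E₁| ≤ u * |KC * W|)
    (hE₂ : |(KR * |dB|) - E₂| ≤ u * |(KR * |dB|)|) (hE : |(E₁ + E₂) - E| ≤ u * |E₁ + E₂|) :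
    (1 - u) ^ 2 * (KC * W) + (1 - u) ^ 2 * (KR * |dB|) ≤ E := by
  have h1u : 0 ≤ 1 - u := by linarith
  have h1 : (1 - u) * (KC * W) ≤ E₁ := lower_of_rel hE₁ (by positivity)
  have h2 : (1 - u) * (KR * |dB|) ≤ E₂ := lower_of_rel hE₂ (by positivity)
  have h10 : 0 ≤ E₁ := le_trans (by positivity) h1
  have h20 : 0 ≤ E₂ := le_trans (by positivity) h2
  have h3 : (1 - u) * (E₁ + E₂) ≤ E := lower_of_rel hE (by linarith)
  have h4 := mul_le_mul_of_nonneg_left (add_le_add h1 h2) h1u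
  nlinarith


/-- Triangle inequality along an identity `x = a + b + c`. -/
private theorem abs_le_of_eq_add3 {x a b c ka kb kc : ℚ} (h : x = a + b + c) (ha : |a| ≤ ka)
    (hb : |b| ≤ kb) (hc : |c| ≤ kc) : |x| ≤ ka + kb + kc := by
  rw [h]
  have a1 := abs_add_le (a + b) c
  have a2 := abs_add_le a b
  linarith

/-- The zeroth-order term of a minor against the computed products. -/
private theorem abs_zminor_le {u z x₁ y₁ x₂ y₂ P Q : ℚ} (hP : |x₁ * y₁ - P| ≤ u * |P|)
    (hQ : |x₂ * y₂ - Q| ≤ u * |Q|) : |z * (x₁ * y₁ - x₂ * y₂)| ≤ (1 + u) * (|z| * (|P| + |Q|)) := by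
  have hP' : |x₁ * y₁| ≤ (1 + u) * |P| := by linarith [abs_sub_abs_le_abs_sub (x₁ * y₁) P]
  have hQ' : |x₂ * y₂| ≤ (1 + u) * |Q| := by linarith [abs_sub_abs_le_abs_sub (x₂ * y₂) Q]
  rw [abs_mul]
  have h := abs_sub (x₁ * y₁) (x₂ * y₂)
  have := mul_le_mul_of_nonneg_left (h.trans (add_le_add hP' hQ')) (abs_nonneg z)
  linarith

/-- Sign transfer: `|a − b| < |a|` forces `b` to have the (strict) sign of `a`, both ways. -/
private theorem sign_iff_of_abs_sub_lt' {a b : ℚ} (h : |a - b| < |a|) :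
    (0 < a ↔ 0 < b) ∧ (a < 0 ↔ b < 0) := by
  rcases lt_trichotomy a 0 with ha | ha | ha
  · rw [abs_of_neg ha] at h
    have h' := abs_lt.mp h
    refine ⟨⟨fun h2 => by linarith, fun h2 => by linarith [h'.1]⟩,
      ⟨fun _ => by linarith [h'.1], fun _ => ha⟩⟩
  · subst ha
    have : (0 : ℚ) < 0 := lt_of_le_of_lt (abs_nonneg (0 - b)) (by simpa using h)
    exact absurd this (lt_irrefl 0)
  · rw [abs_of_pos ha] at h
    have h' := abs_lt.mp h
    refine ⟨⟨fun _ => by linarith [h'.2], fun _ => ha⟩,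
      ⟨fun h2 => by linarith, fun h2 => by linarith [h'.2]⟩⟩

/-! ## Stage C is sound, as an inequality between rationals -/

/-- **The sign test of ORIENT3D's stage C is sound, as an inequality between rationals, for any
constants `K_C`, `K_R` and estimate error `δ` satisfying the two margins**
`23ε² + 70ε³ + 123ε⁴ + 145ε⁵ + 113ε⁶ + 56ε⁷ + 16ε⁸ + 2ε⁹ < (1 − ε)⁷K_C` and `δ < (1 − δ)(1 − ε)³K_R`
(`0 < ε ≤ 1/2`, `0 ≤ δ < 1`).  Data (see the module docstring): the nine computed differences and
their tails (`|tail| ≤ ε|difference|`), the six stage-A products, the 3 × 11 roundings of the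
correction and the 2 of its sum `c`, the permanent chain `W`, the stage-B value `d_B` with
`|d_B − B| ≤ δ|B|`, the returned value `d_C = d_B ⊕ c` (`|d_C − (d_B + c)| ≤ ε|d_C|`), the error
bound `E = (K_C ⊗ W) ⊕ (K_R ⊗ |d_B|)` and the passed test `E ≤ |d_C|`.  Then `d_C` is nonzero
exactly with the sign of the true determinant `T` (over the differences `x + tail`), both ways. -/
theorem orient3d_stageC_sign_of_bounds
    {u δ KC KR xa ya za xb yb zb xc yc zc xat yat zat xbt ybt zbt xct yct zct P₁ P₂ P₃ P₄ P₅ P₆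
      pa₁ pa₂ pa₃ pa₄ sa₁ sa₂ ra ma ea na ta pb₁ pb₂ pb₃ pb₄ sb₁ sb₂ rb mb eb nb tb
      pc₁ pc₂ pc₃ pc₄ sc₁ sc₂ rc mc ec nc tc c₁ c Aa Ab Ac αa αb αc W₁ W dB dC E₁ E₂ E : ℚ}
    (hu0 : 0 < u) (hu1 : u ≤ 1 / 2) (hδ0 : 0 ≤ δ) (hδ1 : δ < 1)
    (hmarginC : 23 * u ^ 2 + 70 * u ^ 3 + 123 * u ^ 4 + 145 * u ^ 5 + 113 * u ^ 6 + 56 * u ^ 7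
      + 16 * u ^ 8 + 2 * u ^ 9 < (1 - u) ^ 7 * KC)
    (hmarginR : δ < (1 - δ) * ((1 - u) ^ 3 * KR))
    -- tails of the differences
    (hxat : |xat| ≤ u * |xa|) (hyat : |yat| ≤ u * |ya|) (hzat : |zat| ≤ u * |za|)
    (hxbt : |xbt| ≤ u * |xb|) (hybt : |ybt| ≤ u * |yb|) (hzbt : |zbt| ≤ u * |zb|)
    (hxct : |xct| ≤ u * |xc|) (hyct : |yct| ≤ u * |yc|) (hzct : |zct| ≤ u * |zc|)
    -- the stage-A products
    (hP₁ : |xb * yc - P₁| ≤ u * |P₁|) (hP₂ : |xc * yb - P₂| ≤ u * |P₂|)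
    (hP₃ : |xc * ya - P₃| ≤ u * |P₃|) (hP₄ : |xa * yc - P₄| ≤ u * |P₄|)
    (hP₅ : |xa * yb - P₅| ≤ u * |P₅|) (hP₆ : |xb * ya - P₆| ≤ u * |P₆|)
    -- term a
    (hpa₁ : |xb * yct - pa₁| ≤ u * |xb * yct|) (hpa₂ : |yc * xbt - pa₂| ≤ u * |yc * xbt|)
    (hpa₃ : |yb * xct - pa₃| ≤ u * |yb * xct|) (hpa₄ : |xc * ybt - pa₄| ≤ u * |xc * ybt|)
    (hsa₁ : |(pa₁ + pa₂) - sa₁| ≤ u * |pa₁ + pa₂|) (hsa₂ : |(pa₃ + pa₄) - sa₂| ≤ u * |pa₃ + pa₄|)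
    (hra : |(sa₁ - sa₂) - ra| ≤ u * |sa₁ - sa₂|) (hma : |za * ra - ma| ≤ u * |za * ra|)
    (hea : |(P₁ - P₂) - ea| ≤ u * |P₁ - P₂|) (hna : |zat * ea - na| ≤ u * |zat * ea|)
    (hta : |(ma + na) - ta| ≤ u * |ma + na|)
    -- term b
    (hpb₁ : |xc * yat - pb₁| ≤ u * |xc * yat|) (hpb₂ : |ya * xct - pb₂| ≤ u * |ya * xct|)
    (hpb₃ : |yc * xat - pb₃| ≤ u * |yc * xat|) (hpb₄ : |xa * yct - pb₄| ≤ u * |xa * yct|)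
    (hsb₁ : |(pb₁ + pb₂) - sb₁| ≤ u * |pb₁ + pb₂|) (hsb₂ : |(pb₃ + pb₄) - sb₂| ≤ u * |pb₃ + pb₄|)
    (hrb : |(sb₁ - sb₂) - rb| ≤ u * |sb₁ - sb₂|) (hmb : |zb * rb - mb| ≤ u * |zb * rb|)
    (heb : |(P₃ - P₄) - eb| ≤ u * |P₃ - P₄|) (hnb : |zbt * eb - nb| ≤ u * |zbt * eb|)
    (htb : |(mb + nb) - tb| ≤ u * |mb + nb|)
    -- term c
    (hpc₁ : |xa * ybt - pc₁| ≤ u * |xa * ybt|) (hpc₂ : |yb * xat - pc₂| ≤ u * |yb * xat|)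
    (hpc₃ : |ya * xbt - pc₃| ≤ u * |ya * xbt|) (hpc₄ : |xb * yat - pc₄| ≤ u * |xb * yat|)
    (hsc₁ : |(pc₁ + pc₂) - sc₁| ≤ u * |pc₁ + pc₂|) (hsc₂ : |(pc₃ + pc₄) - sc₂| ≤ u * |pc₃ + pc₄|)
    (hrc : |(sc₁ - sc₂) - rc| ≤ u * |sc₁ - sc₂|) (hmc : |zc * rc - mc| ≤ u * |zc * rc|)
    (hec : |(P₅ - P₆) - ec| ≤ u * |P₅ - P₆|) (hnc : |zct * ec - nc| ≤ u * |zct * ec|)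
    (htc : |(mc + nc) - tc| ≤ u * |mc + nc|)
    -- the sum of the three terms
    (hc₁ : |(ta + tb) - c₁| ≤ u * |ta + tb|) (hc : |(c₁ + tc) - c| ≤ u * |c₁ + tc|)
    -- the permanent (stage A)
    (hAa : |(|P₁| + |P₂|) - Aa| ≤ u * |(|P₁| + |P₂|)|)
    (hAb : |(|P₃| + |P₄|) - Ab| ≤ u * |(|P₃| + |P₄|)|)
    (hAc : |(|P₅| + |P₆|) - Ac| ≤ u * |(|P₅| + |P₆|)|)
    (hαa : |(Aa * |za|) - αa| ≤ u * |(Aa * |za|)|) (hαb : |(Ab * |zb|) - αb| ≤ u * |(Ab * |zb|)|)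
    (hαc : |(Ac * |zc|) - αc| ≤ u * |(Ac * |zc|)|) (hW₁ : |(αa + αb) - W₁| ≤ u * |αa + αb|)
    (hW : |(W₁ + αc) - W| ≤ u * |W₁ + αc|)
    -- the stage-B estimate, the returned value, the error bound, the test
    (hdB : |dB - (za * (xb * yc - xc * yb) + zb * (xc * ya - xa * yc) + zc * (xa * yb - xb * ya))|
      ≤ δ * |za * (xb * yc - xc * yb) + zb * (xc * ya - xa * yc) + zc * (xa * yb - xb * ya)|)
    (hdC : |dC - (dB + c)| ≤ u * |dC|) (hE₁ : |KC * W - E₁| ≤ u * |KC * W|)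
    (hE₂ : |(KR * |dB|) - E₂| ≤ u * |(KR * |dB|)|) (hE : |(E₁ + E₂) - E| ≤ u * |E₁ + E₂|)
    (htest : E ≤ |dC|) :
    (0 < dC ↔ 0 < (za + zat) * ((xb + xbt) * (yc + yct) - (xc + xct) * (yb + ybt))
        + (zb + zbt) * ((xc + xct) * (ya + yat) - (xa + xat) * (yc + yct))
        + (zc + zct) * ((xa + xat) * (yb + ybt) - (xb + xbt) * (ya + yat))) ∧
      (dC < 0 ↔ (za + zat) * ((xb + xbt) * (yc + yct) - (xc + xct) * (yb + ybt))
        + (zb + zbt) * ((xc + xct) * (ya + yat) - (xa + xat) * (yc + yct))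
        + (zc + zct) * ((xa + xat) * (yb + ybt) - (xb + xbt) * (ya + yat)) < 0) := by
  have hu := hu0.le
  have h1u : 0 < 1 - u := by linarith only [hu1]
  -- the three computed terms, their sum, the three remainders
  obtain ⟨eTa, mTa⟩ := orient3dCTerm_sub_le hu hzat hxbt hyct hxct hybt hP₁ hP₂ hpa₁ hpa₂ hpa₃
    hpa₄ hsa₁ hsa₂ hra hma hea hna hta
  obtain ⟨eTb, mTb⟩ := orient3dCTerm_sub_le hu hzbt hxct hyat hxat hyct hP₃ hP₄ hpb₁ hpb₂ hpb₃
    hpb₄ hsb₁ hsb₂ hrb hmb heb hnb htb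
  obtain ⟨eTc, mTc⟩ := orient3dCTerm_sub_le hu hzct hxat hybt hxbt hyat hP₅ hP₆ hpc₁ hpc₂ hpc₃
    hpc₄ hsc₁ hsc₂ hrc hmc hec hnc htc
  obtain ⟨eL, mL⟩ := orient3dCSum_sub_le hu (by positivity) eTa mTa eTb mTb eTc mTc hc₁ hc
  have rA := orient3dCRemainder_le hu hzat hxbt hyct hxct hybt hP₁ hP₂ (z := za)
  have rB := orient3dCRemainder_le hu hzbt hxct hyat hxat hyct hP₃ hP₄ (z := zb)
  have rC := orient3dCRemainder_le hu hzct hxat hybt hxbt hyat hP₅ hP₆ (z := zc)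
  have bA := abs_zminor_le hP₁ hP₂ (z := za)
  have bB := abs_zminor_le hP₃ hP₄ (z := zb)
  have bC := abs_zminor_le hP₅ hP₆ (z := zc)
  have hW4 := perm_ge hu (by linarith only [hu1]) hAa hAb hAc hαa hαb hαc hW₁ hW
  -- names
  set Pi := |za| * (|P₁| + |P₂|) + |zb| * (|P₃| + |P₄|) + |zc| * (|P₅| + |P₆|) with hPi
  set B := za * (xb * yc - xc * yb) + zb * (xc * ya - xa * yc) + zc * (xa * yb - xb * ya) with hB
  set T := (za + zat) * ((xb + xbt) * (yc + yct) - (xc + xct) * (yb + ybt))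
        + (zb + zbt) * ((xc + xct) * (ya + yat) - (xa + xat) * (yc + yct))
        + (zc + zct) * ((xa + xat) * (yb + ybt) - (xb + xbt) * (ya + yat)) with hT
  set L := (za * ((xb * yct + yc * xbt) - (yb * xct + xc * ybt)) + zat * (xb * yc - yb * xc))
        + (zb * ((xc * yat + ya * xct) - (yc * xat + xa * yct)) + zbt * (xc * ya - yc * xa))
        + (zc * ((xa * ybt + yb * xat) - (ya * xbt + xb * yat)) + zct * (xa * yb - ya * xb)) with hL
  have hPi0 : 0 ≤ Pi := by positivity
  -- the constants are positive
  have hKC : 0 < KC := by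
    have h : 0 < (1 - u) ^ 7 * KC := lt_of_le_of_lt (by positivity) hmarginC
    exact pos_of_mul_pos_right h (pow_nonneg h1u.le 7)
  have hKR : 0 < KR := by
    have h1 : 0 < (1 - δ) * ((1 - u) ^ 3 * KR) := lt_of_le_of_lt hδ0 hmarginR
    have h2 := pos_of_mul_pos_right h1 (by linarith only [hδ1] : 0 ≤ 1 - δ)
    exact pos_of_mul_pos_right h2 (pow_nonneg h1u.le 3)
  have hW0 : 0 ≤ W := le_trans (by positivity) hW4
  have hEge := errC_ge (by linarith only [hu1]) hKC.le hKR.le hW0 hE₁ hE₂ hE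
  -- |B|, |T − B − L| and |L| against Π
  have hBle : |B| ≤ (1 + u) * Pi := by
    have h := abs_le_of_eq_add3 (x := B) (by rw [hB]) bA bB bC
    linarith only [h, hPi]
  have hRle : |T - B - L| ≤ (3 * u ^ 2 + u ^ 3) * (1 + u) * Pi := by
    have h := abs_le_of_eq_add3 (x := T - B - L) (by rw [hT, hB, hL]; ring) rA rB rC
    linarith only [h, hPi]
  have hLle : |L| ≤ ((1 + u) ^ 2 * (3 * u + 15 * u ^ 2 + 33 * u ^ 3 + 41 * u ^ 4 + 30 * u ^ 5
      + 12 * u ^ 6 + 2 * u ^ 7) + (20 * u ^ 2 + 66 * u ^ 3 + 122 * u ^ 4 + 145 * u ^ 5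
      + 113 * u ^ 6 + 56 * u ^ 7 + 16 * u ^ 8 + 2 * u ^ 9)) * Pi := by
    have h1 : |L| - |c| ≤ |L - c| := abs_sub_abs_le_abs_sub L c
    rw [abs_sub_comm] at h1
    linarith only [h1, mL, eL]
  -- the total error
  have hX : |dC - T| ≤ u * |dC| + δ * |B| + (23 * u ^ 2 + 70 * u ^ 3 + 123 * u ^ 4 + 145 * u ^ 5
      + 113 * u ^ 6 + 56 * u ^ 7 + 16 * u ^ 8 + 2 * u ^ 9) * Pi := by
    have key : dC - T = (dC - (dB + c)) + (dB - B) + (c - L) - (T - B - L) := by ring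
    rw [key]
    have a1 := abs_sub ((dC - (dB + c)) + (dB - B) + (c - L)) (T - B - L)
    have a2 := abs_add_le ((dC - (dB + c)) + (dB - B)) (c - L)
    have a3 := abs_add_le (dC - (dB + c)) (dB - B)
    linarith only [a1, a2, a3, hdC, hdB, eL, hRle]
  by_cases hPi00 : Pi = 0
  · -- degenerate: everything vanishes
    rw [hPi00, mul_zero] at hBle hLle hRle mL
    have hB0 : B = 0 := abs_eq_zero.mp (le_antisymm hBle (abs_nonneg _))
    have hL0 : L = 0 := abs_eq_zero.mp (le_antisymm hLle (abs_nonneg _))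
    have hR0 : T - B - L = 0 := abs_eq_zero.mp (le_antisymm hRle (abs_nonneg _))
    have hT0 : T = 0 := by linarith only [hB0, hL0, hR0]
    have hdB0 : dB = 0 := by
      rw [hB0, sub_zero, abs_zero, mul_zero] at hdB
      exact abs_eq_zero.mp (le_antisymm hdB (abs_nonneg _))
    have hc0 : c = 0 := abs_eq_zero.mp (le_antisymm mL (abs_nonneg _))
    have hdC0 : dC = 0 := by
      rw [hdB0, hc0, add_zero, sub_zero] at hdC
      have h2 : |dC| ≤ 0 := by
        by_contra h3
        have h4 := mul_pos h1u (not_le.mp h3)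
        linarith only [hdC, h4]
      exact abs_eq_zero.mp (le_antisymm h2 (abs_nonneg _))
    rw [hdC0, hT0]
    exact ⟨Iff.rfl, Iff.rfl⟩
  · have hPipos : 0 < Pi := lt_of_le_of_ne hPi0 (Ne.symm hPi00)
    have sC := mul_lt_mul_of_pos_right hmarginC hPipos
    have mR : δ * |B| ≤ (1 - u) ^ 3 * KR * |dB| := by
      have m1 := mul_le_mul_of_nonneg_right hmarginR.le (abs_nonneg B)
      have m2 : (1 - δ) * |B| ≤ |dB| := by
        have h1 : |B| - |dB| ≤ |B - dB| := abs_sub_abs_le_abs_sub B dB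
        rw [abs_sub_comm] at h1
        linarith only [h1, hdB]
      have m3 := mul_le_mul_of_nonneg_left m2 (le_of_lt (mul_pos (pow_pos h1u 3) hKR))
      linarith only [m1, m3]
    have t1 := mul_le_mul_of_nonneg_left (hEge.trans htest) h1u.le
    have t2 := mul_le_mul_of_nonneg_left hW4 (le_of_lt (mul_pos (pow_pos h1u 3) hKC))
    have key : |dC - T| < |dC| := by linarith only [hX, sC, mR, t1, t2]
    exact sign_iff_of_abs_sub_lt' key

end Summit.Ventures.CertifiedArithmetic.Expansions
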